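import Summits.HodgeConjecture.HodgeConjecture.Theorems.K2E1bU21HighestWeightSpaces          -- ★ αᵤ-1∕1b: `wtSpace`, `hwSpace`, labels, `iSup_wtSpace_eq_top`, `labelE_eq_of_center`
import Summits.HodgeConjecture.HodgeConjecture.Theorems.K2E1bCarriersOfRecord               -- ★ `σOfRecord`, `ρKOfRecord`, `isGKModule_ofRecord`
import Literature.NumberTheory.Automorphic.GKModulesKActionUnique                            -- ★ `IsGKModule.areGKEquivalent_of_lieEquiv`
import Literature.RepresentationTheory.BorelWallach2000.UpqMaximalCompactExp                  -- ★ `upq_exists_expK_eq`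
import Literature.RepresentationTheory.BorelWallach2000.U11PrincipalSeriesWeightedInequivalent -- ★ `GKSubquot.isIrreducibleGK_of_gkEquiv`
import Literature.RepresentationTheory.GKModuleIrrClass                                       -- ★ `GKIrrep`, `GKIrrClass.mk_eq_mk_iff`
import HarnessLib

/-!
# K2 ∕ E1b — αᵤ road, preliminaries of the HEAD file «MODEL OF RECORD, COH-UNITARY»: nonzero highest-weight vectors; integrality from the labels;
# the class of the record from a `𝔤`-isomorphism

Cell hodgecm-mathlib, Track B «K2-LIT», engine E1b, unit U8; crux item h413 = stmt-HodgeConjecture-24833 (supports-only helper; closes nothing by itself).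
DEAL (D-αᵤ5) K2E1b-plan (g4) 2026-09-04T04:13:05Z ∕ cut 04:27:44Z: the head file `Theorems/K2E1bModelOfRecordCohUnitary.lean :: modelOfRecordCohUnitary :
U8.ModelOfRecordCohUnitaryStmt` (desk K2-defs1 (g3)) = ★ 2c `hwLines_of_isCohUnitaryIrrep` + ★ 4b `exists_datum` + 5b `exists_lieEquiv_of_datum` (K2E4-p10 (g3))
+ THIS FILE's three 5b-independent assembly pieces, landed ahead so the head is a few lines when 5b is ★.  THEOREMS ONLY — no `def`, no `sorry`, no axiom,
no instance declaration (one `attribute [local instance] LieRing.ofAssociativeRing`), no notation.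

§1 `exists_mem_hwSpace_ne_zero` — A NONZERO `(𝔤, K)`-MODULE OF `U(2,1)` HAS A NONZERO `𝔨`-HIGHEST-WEIGHT VECTOR, of any prescribed central label `e` that all
weights carry (the form ★ `labelE_eq_of_center` produces from `HasChiScalars`.2): some `V[w] ≠ 0` (★ `iSup_wtSpace_eq_top`), and the `e`-string of a weight
vector inside its finite-dimensional `K`-span (★ `kFinite`; `e`-stable by ★ `apply_mem_of_K_stable_of_mem_kInLie` + ★ `u21e_apply_mem`) terminates
(`exists_u21e_pow_apply_eq_zero`: `h (e^k v) = (μ + 2k) e^k v`, distinct weights) — its last nonzero member is the vector.  This discharges the binder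
`(hS : ∃ n m, u n m ≠ 0)` of 5b through ★ 4b clause (iii).
§2 `six_dvd_of_labels` — `6 ∣ m − 3n + 3 + 2e` for the labels of an integral weight (★ `labelM_sub_labelN_add_labelE`), the integrality hypothesis of
★ `isGKModule_ofRecord` (MEMO M1), from ★ 4b clauses (i)–(ii).
§3 `exists_mk_eq_mk_ofRecord` — a `𝔤`-isomorphism `Φ : 𝒟.V ≃ₗ[ℂ] r.V` onto an irreducible `r` makes the structure of record a `(𝔤, K)`-module (★
`isGKModule_ofRecord`), `(𝔤, K)`-equivalent to `r` (★ `IsGKModule.areGKEquivalent_of_lieEquiv`, `K = exp 𝔨` ★ `upq_exists_expK_eq`), irreducible (★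
`GKSubquot.isIrreducibleGK_of_gkEquiv`), with `GKIrrClass.mk r = GKIrrClass.mk ⟨𝒟.V, ρKOfRecord 𝒟 e, σOfRecord 𝒟 e, _, _⟩` (★ `GKIrrClass.mk_eq_mk_iff`) — the
literal conclusion shape of `ModelOfRecordCohUnitaryStmt`.

Sources: [Kovacevic2021, §3 Def. 1, Thm. 3; §6]; [KnappVogan1995, §I.4 (1.64)–(1.65), §II.4, §IV.1]; [BorelWallach2000, 0 §2.5].

HONEST LABEL: kernel theorems; helpers of the 8b-αᵤ road, they close no socket by themselves.  HC_CM is proved only modulo the 7 printed citations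
(2 remaining named inputs: hLiu418 = stmt-HodgeConjecture-24832, h413 = stmt-HodgeConjecture-24833) until rung 0 closes.
-/

-- Mathlib idiom (as in ★ `GKModules` and every `(𝔤, K)` file of the tree): the commutator bracket on `Module.End ℂ V` ∕ matrices.
attribute [local instance 100] LieRing.ofAssociativeRing

set_option autoImplicit false
set_option linter.dupNamespace false

noncomputable section

open Module
open Literature.RepresentationTheory Literature.RepresentationTheory.BorelWallach2000
open Literature.RepresentationTheory.KonnoKonno2007 Literature.RepresentationTheory.KonnoKonno2007.RealDualPair
open Literature.RepresentationTheory.Kovacevic2021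
open Literature.NumberTheory.Automorphic
open Summit.HodgeConjecture.HodgeConjecture.Cruxes.H413.F0P3bLocalAPacketsDefs (G21)
open Summit.HodgeConjecture.HodgeConjecture.Cruxes.H413.K2E1bU21Weights
open Summit.HodgeConjecture.HodgeConjecture.Cruxes.H413.K2E1bCarriersOfRecord

namespace Summit.HodgeConjecture.HodgeConjecture.Cruxes.H413.K2E1bModelOfRecord

variable {V : Type*} [AddCommGroup V] [Module ℂ V]
  {ρK : Representation ℂ G21.maximalCompact V} (ρ𝔤 : G21.lie →ₗ⁅ℝ⁆ Module.End ℂ V)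

/-! ## §1 `e`-strings terminate; a nonzero `(𝔤, K)`-module of `U(2,1)` has a nonzero `𝔨`-highest-weight vector -/

/-- **`h (e^k v) = (μ + 2k) e^k v`** for `h v = μ v` (★ `u21h_mul_u21e_sub`: `[h, e] = 2e`). [cite: KnappVogan1995, §IV.1] -/
theorem u21h_apply_u21e_pow_apply {v : V} {μ : ℂ} (hv : u21h ρ𝔤 v = μ • v) (k : ℕ) :
    u21h ρ𝔤 ((u21e ρ𝔤 ^ k) v) = (μ + 2 * k) • (u21e ρ𝔤 ^ k) v := by
  have hrel : ∀ w : V, u21h ρ𝔤 (u21e ρ𝔤 w) = u21e ρ𝔤 (u21h ρ𝔤 w) + (2 : ℂ) • u21e ρ𝔤 w := by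
    intro w
    have h := LinearMap.congr_fun (u21h_mul_u21e_sub ρ𝔤) w
    rw [LinearMap.sub_apply, Module.End.mul_apply, Module.End.mul_apply, LinearMap.smul_apply] at h
    rw [← h, add_sub_cancel]
  induction k with
  | zero => simpa only [pow_zero, Module.End.one_apply, Nat.cast_zero, mul_zero, add_zero] using hv
  | succ k ih =>
    rw [pow_succ', Module.End.mul_apply, hrel, ih, map_smul, ← add_smul]
    congr 1
    push_cast
    ring

/-- **`e`-strings terminate inside a finite-dimensional `e`-stable subspace**: the `e^k v` are `h`-eigenvectors of the distinct weights `μ + 2k`.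
[cite: KnappVogan1995, §IV.1] -/
theorem exists_u21e_pow_apply_eq_zero {U : Submodule ℂ V} [FiniteDimensional ℂ U] (hU : ∀ u ∈ U, u21e ρ𝔤 u ∈ U)
    {v : V} (hvU : v ∈ U) {μ : ℂ} (hv : u21h ρ𝔤 v = μ • v) : ∃ n : ℕ, (u21e ρ𝔤 ^ n) v = 0 := by
  by_contra hne
  push Not at hne
  have hmem : ∀ n : ℕ, (u21e ρ𝔤 ^ n) v ∈ U := by
    intro n
    induction n with
    | zero => simpa only [pow_zero, Module.End.one_apply] using hvU
    | succ n ih => rw [pow_succ', Module.End.mul_apply]; exact hU _ ih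
  set N := Module.finrank ℂ U with hN
  let g : Fin (N + 1) → ↥U := fun i => ⟨(u21e ρ𝔤 ^ (i : ℕ)) v, hmem i⟩
  have hind : LinearIndependent ℂ g := by
    refine LinearIndependent.of_comp U.subtype ?_
    refine Module.End.eigenvectors_linearIndependent' (u21h ρ𝔤) (fun i : Fin (N + 1) => μ + 2 * ((i : ℕ) : ℂ)) ?_ _ ?_
    · intro i j hij
      have h2 : (2 : ℂ) * (i : ℕ) = 2 * (j : ℕ) := add_left_cancel hij
      exact Fin.ext (Nat.cast_injective (R := ℂ) (mul_left_cancel₀ two_ne_zero h2))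
    · intro i
      exact Module.End.hasEigenvector_iff.mpr ⟨Module.End.mem_eigenspace_iff.mpr (u21h_apply_u21e_pow_apply ρ𝔤 hv i), hne i⟩
  have hcard := hind.fintype_card_le_finrank
  rw [Fintype.card_fin] at hcard
  omega

/-- **`e^k V[w] ⊆ V[w + k(δ₀ − δ₁)]`.** [cite: Kovacevic2021, §3 Def. 1] -/
theorem u21e_pow_apply_mem_wtSpace {w : Fin 2 ⊕ Fin 1 → ℤ} {v : V} (hv : v ∈ wtSpace ρ𝔤 w) (k : ℕ) :
    (u21e ρ𝔤 ^ k) v ∈ wtSpace ρ𝔤 (w + k • (Pi.single (Sum.inl 0) 1 - Pi.single (Sum.inl 1) 1)) := by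
  induction k with
  | zero => simpa only [pow_zero, Module.End.one_apply, zero_smul, add_zero] using hv
  | succ k ih =>
    have h := u21e_apply_mem_wtSpace ρ𝔤 ih
    rw [pow_succ', Module.End.mul_apply]
    convert h using 2
    rw [succ_nsmul]
    abel

/-- The central label is constant along `e`-strings: `labelE (w + k(δ₀ − δ₁)) = labelE w`. [cite: Kovacevic2021, §3 Def. 1] -/
theorem labelE_add_nsmul (w : Fin 2 ⊕ Fin 1 → ℤ) (k : ℕ) :
    labelE (w + k • (Pi.single (Sum.inl 0) 1 - Pi.single (Sum.inl 1) 1)) = labelE w := by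
  simp [labelE]
  ring

variable {ρ𝔤} in
/-- **A NONZERO `(𝔤, K)`-MODULE OF `U(2,1)` HAS A NONZERO `𝔨`-HIGHEST-WEIGHT VECTOR**: some `V[w] ≠ 0` (★ `iSup_wtSpace_eq_top`); the `e`-string of a
nonzero weight vector inside its finite-dimensional `K`-span (★ `kFinite`, `e`-stable by ★ `apply_mem_of_K_stable_of_mem_kInLie`) terminates; its last
nonzero member lies in `hwSpace` of a weight with the same central label. [cite: Kovacevic2021, §3 Def. 1] [cite: KnappVogan1995, §IV.1] -/
theorem exists_mem_hwSpace_ne_zero (hV : IsGKModule G21 ρK ρ𝔤) [Nontrivial V] :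
    ∀ e : ℤ, (∀ (w : Fin 2 ⊕ Fin 1 → ℤ) (v : V), v ∈ wtSpace ρ𝔤 w → v ≠ 0 → labelE w = e) →
      ∃ (w : Fin 2 ⊕ Fin 1 → ℤ) (g : V), g ∈ hwSpace ρ𝔤 w ∧ g ≠ 0 ∧ labelE w = e := by
  intro e he
  classical
  -- some weight space is nonzero
  have hex : ∃ (w : Fin 2 ⊕ Fin 1 → ℤ) (v : V), v ∈ wtSpace ρ𝔤 w ∧ v ≠ 0 := by
    by_contra hno
    push Not at hno
    have hbot : ∀ w : Fin 2 ⊕ Fin 1 → ℤ, wtSpace ρ𝔤 w = ⊥ := fun w => (Submodule.eq_bot_iff _).mpr (hno w)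
    have htop := iSup_wtSpace_eq_top (ρ𝔤 := ρ𝔤) hV
    simp only [hbot, iSup_bot] at htop
    exact bot_ne_top htop
  obtain ⟨w, v, hv, hv0⟩ := hex
  -- the `e`-string of `v` inside the `K`-span terminates
  haveI : FiniteDimensional ℂ (Submodule.span ℂ (Set.range fun k : G21.maximalCompact => ρK k v)) := hV.kFinite v
  have hFk : ∀ Y ∈ G21.kInLie, ∀ u ∈ Submodule.span ℂ (Set.range fun k : G21.maximalCompact => ρK k v), ρ𝔤 Y u ∈
      Submodule.span ℂ (Set.range fun k : G21.maximalCompact => ρK k v) :=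
    fun Y hY u hu => apply_mem_of_K_stable_of_mem_kInLie ρK hV (fun k u hu => GKWeights.kSpan_stable v k hu) hY hu
  have hter := exists_u21e_pow_apply_eq_zero ρ𝔤 (fun u hu => u21e_apply_mem ρ𝔤 hFk hu) (GKWeights.mem_kSpan v)
    (u21h_apply_of_mem_wtSpace' ρ𝔤 hv)
  have hj0 : Nat.find hter ≠ 0 := by
    intro h0
    have h1 := Nat.find_spec hter
    rw [h0, pow_zero, Module.End.one_apply] at h1
    exact hv0 h1
  refine ⟨w + (Nat.find hter - 1) • (Pi.single (Sum.inl 0) 1 - Pi.single (Sum.inl 1) 1), (u21e ρ𝔤 ^ (Nat.find hter - 1)) v, ?_, ?_, ?_⟩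
  · rw [mem_hwSpace_iff]
    refine ⟨u21e_pow_apply_mem_wtSpace ρ𝔤 hv _, ?_⟩
    rw [← Module.End.mul_apply, ← pow_succ', Nat.sub_add_cancel (by omega)]
    exact Nat.find_spec hter
  · exact Nat.find_min hter (by omega)
  · rw [labelE_add_nsmul]; exact he w v hv hv0

/-! ## §2 Integrality of the record from the labels -/

/-- **`6 ∣ m − 3n + 3 + 2e`** for the labels `(n, m, e)` of an integral torus weight (★ `labelM_sub_labelN_add_labelE`: the quantity is `6w₁`).
[cite: Kovacevic2021, §6] [cite: BorelWallach2000, 0 §2.5] -/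
theorem six_dvd_of_labels {w : Fin 2 ⊕ Fin 1 → ℤ} {n m e : ℤ} (hN : labelN w = n) (hM : labelM w = m) (hE : labelE w = e) :
    (6 : ℤ) ∣ m - 3 * n + 3 + 2 * e := by
  rw [← hN, ← hM, ← hE, labelM_sub_labelN_add_labelE]
  exact dvd_mul_right 6 _

/-! ## §3 The class of `r` is the class of the record, given a `𝔤`-isomorphism -/

/-- **A `𝔤`-ISOMORPHISM `𝒟.V ≃ r.V` PINS THE CLASS**: if the twisted structure of record `(ρKOfRecord 𝒟 e, σOfRecord 𝒟 e)` of an `e`-integral datum is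
`𝔤`-isomorphic to an irreducible `(𝔤, K)`-module `r` of `U(2,1)`, it is a `(𝔤, K)`-module (★ `isGKModule_ofRecord`), `(𝔤, K)`-equivalent to `r`
(★ `IsGKModule.areGKEquivalent_of_lieEquiv`, `K = exp 𝔨` by ★ `upq_exists_expK_eq`), irreducible by transport (★ `GKSubquot.isIrreducibleGK_of_gkEquiv`),
and `GKIrrClass.mk r` is its class (★ `GKIrrClass.mk_eq_mk_iff`). [cite: KnappVogan1995, §I.4 (1.64)–(1.65), §II.4] [cite: BorelWallach2000, 0 §2.5] -/
theorem exists_mk_eq_mk_ofRecord (r : GKIrrep G21) (e : ℤ) (𝒟 : SU21Datum)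
    (hdiv : ∀ n m : ℤ, (n, m) ∈ 𝒟.S → (6 : ℤ) ∣ m - 3 * n + 3 + 2 * e)
    (Φ : 𝒟.V ≃ₗ[ℂ] r.V) (hΦ : ∀ (X : G21.lie) (x : 𝒟.V), Φ (σOfRecord 𝒟 e X x) = r.ρ𝔤 X (Φ x)) :
    ∃ (hGK : IsGKModule G21 (ρKOfRecord 𝒟 e) (σOfRecord 𝒟 e)) (hirr : IsIrreducibleGK (ρKOfRecord 𝒟 e) (σOfRecord 𝒟 e)),
      GKIrrClass.mk r = GKIrrClass.mk ⟨𝒟.V, ρKOfRecord 𝒟 e, σOfRecord 𝒟 e, hGK, hirr⟩ := by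
  have hGK : IsGKModule G21 (ρKOfRecord 𝒟 e) (σOfRecord 𝒟 e) := isGKModule_ofRecord 𝒟 e hdiv
  obtain ⟨E⟩ := IsGKModule.areGKEquivalent_of_lieEquiv hGK r.isGKModule Φ hΦ upq_exists_expK_eq
  have hirr : IsIrreducibleGK (ρKOfRecord 𝒟 e) (σOfRecord 𝒟 e) := GKSubquot.isIrreducibleGK_of_gkEquiv E.symm' r.isIrreducible
  exact ⟨hGK, hirr, (GKIrrClass.mk_eq_mk_iff _ _).mpr ⟨E.symm'⟩⟩

end Summit.HodgeConjecture.HodgeConjecture.Cruxes.H413.K2E1bModelOfRecord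

end
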